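/-
COR-CM (cell pub-hodgecm2) — Δ2 BRIDGE, VERSION-B item (1)(b) «Ω-PIN AT δ′», the KEYS AT THE ENUMERATED PIN (pair file of d2bridge-prove-6's
GENERIC Ω-pin `CorCM/D2Bridge/OmegaPinAtDeltaPrime.lean`).  Seat prover-pub-hodgecm2-d2bridge-prove-7-g0-0, 2026-08-23.
THEOREMS ONLY (assembler DECISION #10: the Ω row is kernel-lane); no definition, no named fact, no instance; every hypothesis is an explicit
binder; nothing landed is edited or restated.  HC_CM is NOT proved; «Δ2 BRIDGE CLOSED» is NOT claimed; hLiu = «[Liu21] Thm 4.18 at the constructed objects AS A READING (r8)»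
until δ′ + the pins land AND the referee signs.
-/
import Summits.HodgeConjecture.CorCM.D2Bridge.OmegaPinAtDeltaPrime
import Summits.HodgeConjecture.HodgeCM.Model.LiuIndexCentralType_1
import HarnessLib

/-!
# Ω-pin at δ′ — the keys at the pinned dictionary's index lines `LiuIndex.line V ρ μ₀ i`

The pinned dictionary of record is `T := liuDictionaryPin … V (LiuIndex.I V ρ μ₀) (LiuIndex.line V ρ μ₀)` (port `Model/LiuDictionaryPin`,
`Model/LiuIndexCentralType`; at the head `hM_of_port`: `ρ := repAt a₀`, `μ₀ := muLiu ι₁ GramClass.rep`).  By `rfl`: `T.Char = I V ρ μ₀`,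
`T.Adm i = {χ : (line i).CharW // (line i).IsAutChar χ}`, `T.Ω i a = (line i).Ω ιV a.1`, `T.PhiMu i = SplitLine.PhiMuLine ι₁ (line i)`, and
`line V ρ μ₀ i = SplitLineE.ofCM V e₁ (vec (ρ i.1)) (vec_real _) (vec_ne _) i.2.1 i.2.2.1` (`lineOf_def`), i.e. the index line over the class
`i.1` has Gram matrix `diagonal (fun _ ↦ (ρ i.1).1)`, rational form `realDiagonal L (fun _ ↦ (ρ i.1).1) _` and pair splitting `i.2.1`.

The δ′ rest on that line is prove-4's `restOfCharDeltaPrime … r μ hμ hw` (F4 `CorCM/D2Bridge/OmegaAtDeltaPrime`, normaliser `(2δ_L)⁻¹`) at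
a section `r` THROUGH `u_a` (`r (locF u_a) = u_a`, `a := (ρ i.1).1`; DECISION #9's value is `repOfLine a := Rep.update Rep.ofLineOf (locF u_a) u_a rfl`, F5), and the Ω-slot binders
`σ ∕ hσ ∕ e ∕ he` of `PinSignatures.thm418C_ofTower_of_pins` are supplied there by prove-6's generic Ω-pin (`Model.exists_omegaPin_line`, theorems-only file of record) ONCE four keys are turned per line:

* (k1) `isOpen_ker_and_rational_of_isAutChar` — `(line i).IsAutChar χ` IS the transport's «open kernel ∧ trivial on `U(W)(L⁺)`»
  (`SplitLine.isAutChar_iff`, port L64);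
* (k2) `JW_rep_line ∕ TW_rep_line` — the line-of-record equalities `J_W (r ε_a) = (line i).JW`, `T_W (r ε_a) = (line i).TW` for a section through
  `u_a` (F2 `JW_realUnit ∕ TW_realUnit`; the seam `RealScalar.vec a = lineVec L a.1 = fun _ ↦ a.1` is reducible-definitional), and
  `update_toFun_line` (`Rep.update Rep.ofLineOf (locF u_a) u_a rfl` — F5's `repOfLine a` unfolded — is such a section, `Rep.update_toFun_self`);
* (k3) `deltaPos_of_hasCMType_line` ∕ `deltaPos_rep_of_hasCMType_line` — the orientation hypothesis `∀ τ ∈ Φ_μ, 0 < Im τ(δ_L · (ρ i.1).1)` of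
  `admIndexAtDeltaPrime` FROM `HasCMType μ (line i).lineType` (`IsConjugateSymplectic.cmType_eq` + `lineOf_lineType` + `SignRecipe.mem_lineType_iff`,
  `η_L = δ_L` by `rfl`);
* (k4) `line_s_eq_chiSplittingLine_iff` — the splitting equation `(line i).s = ι_{toHecke μ}` over the explicit Gram data of the class (pin-3's
  spelling) ↔ over the record's fields (the transport's spelling), `Iff.rfl`, so that X3-Char item (E)
  (`Transposition/Item6CentralTypeAtPinIndex.exists_weightOne_line_s_eq_chiSplittingLine_toHeckeCharacter`) feeds prove-6's `hsEq`.

§3 packages, Prop-level and THEOREMS ONLY, the Ω-slot `σ ∕ hσ ∕ e ∕ he` per line (`exists_pinTerms_line`: prove-6's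
`exists_omegaPin_line` at `p := line i`, section `(r, hr)`, rest `(R, hR)` — a binder identified with the δ′ rest, prove-6's composition
seam: at the composition `R := (U i hi hg).rest (tail i hi hg)`, `hR :=` own-htheta's `restOfCharRep_eq_rest` — and key
`(μ, hμ, hw, hΦμ, hsEq)`), and in the binder shape `∀ (i : I V ρ μ₀) (hi : PhiMuLine ι₁ (line i)) (hg : Good i), …` of
`PinSignatures.thm418C_ofTower_of_pins` for ANY `Good` with a key family (`exists_pinTerms`; `exists_pinTerms_update` at DECISION #9's
sections).  The key OF RECORD (`Good i := Continuous i.2.1`, `ρ := repAt a₀`, `μ₀ := muLiu ι₁ rep`) is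
pin-3's X3-Char theorem; it is consumed in the sequel `OmegaPinAtLiuIndexOfRecord.lean`, not here.
HC_CM is NOT proved.
-/

set_option autoImplicit false

noncomputable section

open scoped TensorProduct Matrix

namespace HodgeCM.Model.LiuIndex.OmegaPin

open NumberField NumberField.InfinitePlace IsDedekindDomain
open Literature.AlgebraicGeometry.Motives
open Literature.AlgebraicGeometry.ShimuraVarieties
open Literature.AlgebraicGeometry.ShimuraVarieties.UnitaryCanonicalModel
open Literature.NumberTheory.Automorphic
open Literature.NumberTheory.Automorphic.IdeleClassGroup
open Literature.NumberTheory.Automorphic.Liu2021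
open Literature.NumberTheory.Automorphic.Liu2021.AppendixC
open Literature.NumberTheory.Automorphic.Liu2021.Def411WeilCarriers (JW TW locF Rep Eps)
open Literature.NumberTheory.Automorphic.Liu2021.Def411WeilCarriersDoubling
open Literature.NumberTheory.GelbartRogawski1991 Literature.NumberTheory.GelbartRogawski1991.UnitaryDualPair
open Summit.HodgeConjecture.CorCM
open Summit.HodgeConjecture.CorCM.Transposition.OmegaTransport (realUnit JW_realUnit TW_realUnit)
open Literature.RepresentationTheory.Liu2021 (isOscillatorChar_toHeckeCharacter_iff)
open HodgeCM.Model.ArchSideTerm (e₁)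

variable {L : HodgeCM.CMField} {ι₁ : (L : Type) →+* ℂ} (V : HodgeCM.HermSpace3 L ι₁)
  (ρ : GramClass L → RealScalar L) (μ₀ : GramClass L → InfinitePlace (L : Type) → ℤ)

/-! ## §1 The keys (k1), (k3), (k4) — equalities and unfoldings of tree objects, no print content -/

/-- (k1) **the `GoodChar` of record IS the transport's character condition**: `(line i).IsAutChar χ` gives «`ker χ` open ∧ `χ` trivial on the
rational points `U(W)(L⁺)`» (`SplitLine.isAutChar_iff`). [folklore] -/
theorem isOpen_ker_and_rational_of_isAutChar (i : I V ρ μ₀) (χ : (line V ρ μ₀ i).CharW) (hχ : (line V ρ μ₀ i).IsAutChar χ) :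
    IsOpen ((χ.ker : Subgroup _) : Set ↥(UnitaryGroup.finAdelic (↥(maximalRealSubfield (L : Type))) (L : Type)
        (IsCMField.complexConj (L : Type)) 1 (line V ρ μ₀ i).JW)) ∧
      ∀ γ, χ (UnitaryGroup.rationalToFinAdelic (↥(maximalRealSubfield (L : Type))) (L : Type)
        (IsCMField.complexConj (L : Type)) 1 (line V ρ μ₀ i).JW γ) = 1 :=
  ((line V ρ μ₀ i).isAutChar_iff χ).1 hχ

/-- (k3) **the orientation hypothesis of `σ` FROM the key's CM type**: if `Φ_μ = (line i).lineType = Φ^δ((ρ i.1).1)` then `Φ_μ` is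
`δ_L`-positive at the line's Gram scalar: `∀ τ ∈ Φ_μ, 0 < Im τ(δ_L · (ρ i.1).1)` — the literal `hΦ` of prove-4's `admIndexAtDeltaPrimeLine` (at `repOfLine a`; `admIndexAtDeltaPrime` at a section through `u_a`, §2)
(`η_L = δ_L` is `rfl`, `SignRecipe.mem_lineType_iff` is `Iff.rfl`). [cite: Liu2021, Def. 4.12 (FJcycle.tex l. 2102–2108)] -/
theorem deltaPos_of_hasCMType_line (i : I V ρ μ₀) {μ : Literature.NumberTheory.Automorphic.IdeleClassGroup (L : Type) →ₜ* Circle}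
    (hμ : IsConjugateSymplectic (L : Type) μ) (hΦμ : HasCMType (L : Type) μ (line V ρ μ₀ i).lineType) :
    ∀ τ : (L : Type) →+* ℂ, τ ∈ hμ.cmType.1 → 0 < (τ (imagUnit (L : Type) * (ρ i.1).1)).im := by
  have h1 : hμ.cmType =
      SignRecipe.lineType (GramClass.scalar ρ i.1) (GramClass.conj_scalar ρ i.1) (GramClass.scalar_ne ρ i.1) :=
    (hμ.cmType_eq hΦμ).trans (lineOf_lineType V ρ (CentralTypeIs V μ₀) i)
  intro τ hτ
  rw [h1] at hτ
  exact hτ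

/-- (k4) **the splitting equation at the line's own Gram data**: the X3-Char equation `(line i).s = ι_{toHecke μ}` stated over the
explicit Gram data `(realDiagonal L (vec (ρ i.1)) _, diagonal (vec (ρ i.1)))` of the class (pin-3's spelling, up to the proof-irrelevant third
argument of `chiSplittingLine`) IS the equation over the record's fields `(line i).TW ∕ .hWd ∕ .JW ∕ .hJW` (the transport's spelling). [folklore] -/
theorem line_s_eq_chiSplittingLine_iff (i : I V ρ μ₀) (μ : Literature.NumberTheory.Automorphic.IdeleClassGroup (L : Type) →ₜ* Circle)
    (hμ : IsConjugateSymplectic (L : Type) μ) :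
    (line V ρ μ₀ i).s =
        chiSplittingLine (L : Type) e₁ (frameD V) (frameD_real V) (frameD_ne V) (toHeckeCharacter (L : Type) μ)
          (isUnitary_toHeckeCharacter (L : Type) μ) ((isOscillatorChar_toHeckeCharacter_iff μ).mpr hμ)
          (realDiagonal (L : Type) (RealScalar.vec (ρ i.1)) (RealScalar.vec_real (ρ i.1)))
          (isUnit_det_realDiagonal (L : Type) (RealScalar.vec (ρ i.1)) (RealScalar.vec_real (ρ i.1)) (RealScalar.vec_ne (ρ i.1)))
          (Matrix.diagonal (RealScalar.vec (ρ i.1)))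
          (realDiagonal_map (L : Type) (RealScalar.vec (ρ i.1)) (RealScalar.vec_real (ρ i.1))).symm ↔
      (line V ρ μ₀ i).s =
        chiSplittingLine (L : Type) e₁ (frameD V) (frameD_real V) (frameD_ne V) (toHeckeCharacter (L : Type) μ)
          (isUnitary_toHeckeCharacter (L : Type) μ) ((isOscillatorChar_toHeckeCharacter_iff μ).mpr hμ)
          (line V ρ μ₀ i).TW (line V ρ μ₀ i).hWd (line V ρ μ₀ i).JW (line V ρ μ₀ i).hJW :=
  Iff.rfl

/-! ## §2 The key (k2) — the line-of-record equalities for a section `r` THROUGH `u_a` (`hr : r (locF u_a) = u_a`, `a := (ρ i.1).1`)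

At the pin the section is either prove-4's `repOfLine a` (F5; `hr` = `repOfLine_toFun_self`) or the composition's μ-dependent family
`r μ hμ` re-pointed at every line of record carrying `μ` ((R-unif) (a)); both are values of `(r, hr)`. -/

/-- (k2) **`J_W (r ε_a) = (line i).JW`** for a section through `u_a` (`(line i).JW = diagonal (vec (ρ i.1))`, `vec a = fun _ ↦ a.1` reducibly;
F2 `OmegaTransport.JW_realUnit`). [folklore] -/
theorem JW_rep_line (i : I V ρ μ₀) (r : Rep ↥(maximalRealSubfield (L : Type)) (imagUnitSq (L : Type)))
    (hr : r.toFun (locF ↥(maximalRealSubfield (L : Type)) (imagUnitSq (L : Type)) (realUnit ⟨L.K⟩ (ρ i.1).1 (ρ i.1).2.1 (ρ i.1).2.2)) =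
      realUnit ⟨L.K⟩ (ρ i.1).1 (ρ i.1).2.1 (ρ i.1).2.2) :
    JW ↥(maximalRealSubfield (L : Type)) (L : Type)
        (r.toFun (locF ↥(maximalRealSubfield (L : Type)) (imagUnitSq (L : Type)) (realUnit ⟨L.K⟩ (ρ i.1).1 (ρ i.1).2.1 (ρ i.1).2.2))) =
      (line V ρ μ₀ i).JW := by
  rw [hr]
  exact JW_realUnit ⟨L.K⟩ (ρ i.1).1 (ρ i.1).2.1 (ρ i.1).2.2

/-- (k2) **`T_W (r ε_a) = (line i).TW`** for a section through `u_a` (F2 `OmegaTransport.TW_realUnit`). [folklore] -/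
theorem TW_rep_line (i : I V ρ μ₀) (r : Rep ↥(maximalRealSubfield (L : Type)) (imagUnitSq (L : Type)))
    (hr : r.toFun (locF ↥(maximalRealSubfield (L : Type)) (imagUnitSq (L : Type)) (realUnit ⟨L.K⟩ (ρ i.1).1 (ρ i.1).2.1 (ρ i.1).2.2)) =
      realUnit ⟨L.K⟩ (ρ i.1).1 (ρ i.1).2.1 (ρ i.1).2.2) :
    TW ↥(maximalRealSubfield (L : Type))
        (r.toFun (locF ↥(maximalRealSubfield (L : Type)) (imagUnitSq (L : Type)) (realUnit ⟨L.K⟩ (ρ i.1).1 (ρ i.1).2.1 (ρ i.1).2.2))) =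
      (line V ρ μ₀ i).TW := by
  rw [hr]
  exact TW_realUnit ⟨L.K⟩ (ρ i.1).1 (ρ i.1).2.1 (ρ i.1).2.2

/-- (k2 + k3) the orientation hypothesis of F4's `admIndexAtDeltaPrime` at a section through `u_a`: `Φ_μ` is `δ_L`-positive at `r ε_a`
(`algebraMap (u_a) = a` is `rfl`). [cite: Liu2021, Def. 4.12 (FJcycle.tex l. 2102–2108)] -/
theorem deltaPos_rep_of_hasCMType_line (i : I V ρ μ₀) (r : Rep ↥(maximalRealSubfield (L : Type)) (imagUnitSq (L : Type)))
    (hr : r.toFun (locF ↥(maximalRealSubfield (L : Type)) (imagUnitSq (L : Type)) (realUnit ⟨L.K⟩ (ρ i.1).1 (ρ i.1).2.1 (ρ i.1).2.2)) =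
      realUnit ⟨L.K⟩ (ρ i.1).1 (ρ i.1).2.1 (ρ i.1).2.2)
    {μ : Literature.NumberTheory.Automorphic.IdeleClassGroup (L : Type) →ₜ* Circle} (hμ : IsConjugateSymplectic (L : Type) μ)
    (hΦμ : HasCMType (L : Type) μ (line V ρ μ₀ i).lineType) :
    ∀ τ : (L : Type) →+* ℂ, τ ∈ hμ.cmType.1 → 0 < (τ (imagUnit (L : Type) * algebraMap ↥(maximalRealSubfield (L : Type)) (L : Type)
      (r.toFun (locF ↥(maximalRealSubfield (L : Type)) (imagUnitSq (L : Type)) (realUnit ⟨L.K⟩ (ρ i.1).1 (ρ i.1).2.1 (ρ i.1).2.2))))).im := by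
  rw [hr]
  exact deltaPos_of_hasCMType_line V ρ μ₀ i hμ hΦμ

/-- (k2, DECISION #9's section) **`Rep.update Rep.ofLineOf (locF u_a) u_a rfl` IS a section through `u_a`** (= prove-4's `repOfLine a`,
F5, unfolded; `Rep.update_toFun_self`). [folklore] -/
theorem update_toFun_line (i : I V ρ μ₀) :
    (Rep.update ↥(maximalRealSubfield (L : Type)) (imagUnitSq (L : Type))
        (Rep.ofLineOf ↥(maximalRealSubfield (L : Type)) (imagUnitSq (L : Type)))
        (locF ↥(maximalRealSubfield (L : Type)) (imagUnitSq (L : Type)) (realUnit ⟨L.K⟩ (ρ i.1).1 (ρ i.1).2.1 (ρ i.1).2.2))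
        (realUnit ⟨L.K⟩ (ρ i.1).1 (ρ i.1).2.1 (ρ i.1).2.2) rfl).toFun
        (locF ↥(maximalRealSubfield (L : Type)) (imagUnitSq (L : Type)) (realUnit ⟨L.K⟩ (ρ i.1).1 (ρ i.1).2.1 (ρ i.1).2.2)) =
      realUnit ⟨L.K⟩ (ρ i.1).1 (ρ i.1).2.1 (ρ i.1).2.2 :=
  Rep.update_toFun_self _ _ _ _ _ _

/-! ## §3 The Ω-slot per line and in the binder shape of the S∞ theorems — THEOREMS ONLY (DECISION #10)

All over the App-C carrier of record `C := sec42DataOf h isoOf ⟨L.K⟩ ι₁ ⟨V.Hm, …⟩ Φ` (its group IS `↥V.adelicFin`, `honestP5Of_G` `rfl`), the frame of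
record `(e₁, frameD V)` and ANY pullback hom `ιV : ↥V.adelicFin →* U(diag (frameD V))(𝔸_f)` (at the pin: `ιVE V`); the rest is a binder `R`
identified by `hR : restOfCharDeltaPrime … e₁ (frameD V) … ιV r μ hμ hw = R` (at the composition: `(U i hi hg).rest (tail i hi hg)` and own-htheta's
`restOfCharRep_eq_rest` BY NAME; `restOfCharDeltaPrime …, rfl` is the canonical value). -/

section PerLine


set_option maxHeartbeats 2000000 in
/-- **THE Ω-SLOT OF ONE INDEX LINE** `i` — `σ ∕ hσ ∕ e ∕ he` EXIST at a section `r` through `u_a` (`hr`), a rest `R` identified with the δ′ rest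
(`hR`) and a key `(μ, hμ, hw, hΦμ, hsEq)`: prove-6's `exists_omegaPin_line` at `p := line i` with the keys turned — `ε := locF u_a`, the
orientation (k2+k3), `T_W ∕ J_W` (k2), the line's own splitting `(line i).s ∕ .hs` with `hsEq` (X3-Char item (E)), `Adm := {χ ∕∕ (line i).IsAutChar χ}`,
`χof := (·.1)` (k1).  (The witness `σ` is F4's `admIndexAtDeltaPrime`, whose `Eps`-label is `locF u_a` = the δ′-collection of the printed
Def. 4.12 label `u_a·(2δ_L)⁻¹` — F4 `admIndexAtDeltaPrime_fst`; that label identity lives inside the witness and is NOT exported through the ∃.)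
[cite: Liu2021, Def. 4.11 (FJcycle.tex l. 2088–2096), Def. 4.12 (l. 2102–2108), Thm. 4.18 (l. 2232–2237), App. D §D.1 Steps 1–3 (l. 5215–5221)]
[cite: GelbartRogawski1991, §3.1 Prop. 3.1.1 p. 455 L1–3, Remark p. 457 L4–13] -/
theorem exists_pinTerms_line
    (ιV : ↥V.adelicFin →*
      ↥(UnitaryGroup.finAdelic (↥(maximalRealSubfield (L : Type))) (L : Type) (IsCMField.complexConj (L : Type)) 3
        (Matrix.diagonal (frameD V))))
    (h : exists_recordSystem) [IsGalois ℚ (L : Type)] (h6 : 6 ≤ Module.finrank ℚ (L : Type)) (Φ : CMType (L : Type))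
    (i : I V ρ μ₀) (r : Rep ↥(maximalRealSubfield (L : Type)) (imagUnitSq (L : Type)))
    (hr : r.toFun (locF ↥(maximalRealSubfield (L : Type)) (imagUnitSq (L : Type)) (realUnit ⟨L.K⟩ (ρ i.1).1 (ρ i.1).2.1 (ρ i.1).2.2)) =
      realUnit ⟨L.K⟩ (ρ i.1).1 (ρ i.1).2.1 (ρ i.1).2.2)
    (μ : Literature.NumberTheory.Automorphic.IdeleClassGroup (L : Type) →ₜ* Circle) (hμ : IsConjugateSymplectic (L : Type) μ)
    (hw : HasWeight (L : Type) μ 1)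
    (R : Thm418Rest (Model.sec42DataOf h Model.isoOf ⟨L.K⟩ ι₁ ⟨V.Hm, V.isHermitian, V.signature_ι₁, V.posDef_of_ne⟩ Φ))
    (hR : Model.restOfCharDeltaPrime h ⟨L.K⟩ h6 ι₁ ⟨V.Hm, V.isHermitian, V.signature_ι₁, V.posDef_of_ne⟩ Φ e₁ (frameD V)
      (frameD_real V) (frameD_ne V) ιV r μ hμ hw = R)
    (hΦμ : HasCMType (L : Type) μ (line V ρ μ₀ i).lineType)
    (hsEq : (line V ρ μ₀ i).s =
      chiSplittingLine (L : Type) e₁ (frameD V) (frameD_real V) (frameD_ne V) (toHeckeCharacter (L : Type) μ)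
        (isUnitary_toHeckeCharacter (L : Type) μ) ((isOscillatorChar_toHeckeCharacter_iff μ).mpr hμ)
        (line V ρ μ₀ i).TW (line V ρ μ₀ i).hWd (line V ρ μ₀ i).JW (line V ρ μ₀ i).hJW) :
    ∃ (σ : {χ : (line V ρ μ₀ i).CharW // (line V ρ μ₀ i).IsAutChar χ} → (toThm418Data _ R).AdmIndex) (_ : Function.Injective σ)
      (e : ∀ a : {χ : (line V ρ μ₀ i).CharW // (line V ρ μ₀ i).IsAutChar χ}, (line V ρ μ₀ i).Ω ιV a.1 ≃ₗ[ℂ] (toThm418Data _ R).omegaAt (σ a)),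
      ∀ (a : {χ : (line V ρ μ₀ i).CharW // (line V ρ μ₀ i).IsAutChar χ}) (g : ↥V.adelicFin) (m : (line V ρ μ₀ i).Ω ιV a.1),
        e a (MonoidAlgebra.of ℂ ↥V.adelicFin g • m) = (toThm418Data _ R).rhoAt (σ a) g (e a m) :=
  Model.exists_omegaPin_line h ⟨L.K⟩ h6 ι₁ ⟨V.Hm, V.isHermitian, V.signature_ι₁, V.posDef_of_ne⟩ Φ e₁ (frameD V) (frameD_real V)
    (frameD_ne V) ιV r μ hμ hw R hR
    (locF ↥(maximalRealSubfield (L : Type)) (imagUnitSq (L : Type)) (realUnit ⟨L.K⟩ (ρ i.1).1 (ρ i.1).2.1 (ρ i.1).2.2))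
    ⟨realUnit ⟨L.K⟩ (ρ i.1).1 (ρ i.1).2.1 (ρ i.1).2.2, rfl⟩ (deltaPos_rep_of_hasCMType_line V ρ μ₀ i r hr hμ hΦμ)
    (line V ρ μ₀ i).TW (line V ρ μ₀ i).JW (line V ρ μ₀ i).hW (line V ρ μ₀ i).hWd (line V ρ μ₀ i).hJW
    (TW_rep_line V ρ μ₀ i r hr) (JW_rep_line V ρ μ₀ i r hr) (line V ρ μ₀ i).s (line V ρ μ₀ i).hs hsEq
    (fun a : {χ : (line V ρ μ₀ i).CharW // (line V ρ μ₀ i).IsAutChar χ} => a.1)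
    (fun a => isOpen_ker_and_rational_of_isAutChar V ρ μ₀ i a.1 a.2) Subtype.val_injective

end PerLine

section Packaging


/-- **THE Ω-SLOT OF THE PINNED DICTIONARY, PACKAGED** in the binder shape `∀ (i) (hi : PhiMuLine ι₁ (line i)) (hg : Good i)` of
`PinSignatures.thm418C_ofTower_of_pins`: for any goodness predicate with a KEY at every good line — a conjugate-symplectic weight-one `μ` with
`Φ_μ = (line i).lineType` and `(line i).s = ι_{toHecke μ}` (at the index of record: pin-3's X3-Char theorem for the continuous lines) —
sections `r i hi hg` through the lines of record (`hr`) and rests `R i hi hg μ hμ hw` identified with the δ′ rests (`hR`), there are families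
`μ ∕ hμ ∕ hw` and `σ ∕ e` over `R i hi hg (μ i hi hg) …` with `hσ`, `he` and the CM-type identity (`hadm` seam).  `exists_pinTerms_line` at every
good line; `Classical.choice` inside the proof only.  HC_CM is NOT proved; «Δ2 BRIDGE CLOSED» is NOT claimed.
[cite: Liu2021, Thm. 4.18 (FJcycle.tex l. 2232–2237), Def. 4.11 (l. 2088–2096), Def. 4.12 (l. 2102–2108), App. D §D.1 Steps 1–3 (l. 5215–5221)]
[cite: GelbartRogawski1991, §3.1 Prop. 3.1.1 p. 455 L1–3] -/
theorem exists_pinTerms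
    (ιV : ↥V.adelicFin →*
      ↥(UnitaryGroup.finAdelic (↥(maximalRealSubfield (L : Type))) (L : Type) (IsCMField.complexConj (L : Type)) 3
        (Matrix.diagonal (frameD V))))
    (h : exists_recordSystem) [IsGalois ℚ (L : Type)] (h6 : 6 ≤ Module.finrank ℚ (L : Type)) (Φ : CMType (L : Type))
    (Good : I V ρ μ₀ → Prop)
    (key : ∀ i : I V ρ μ₀, SplitLine.PhiMuLine ι₁ (line V ρ μ₀ i) → Good i →
      ∃ (μ : Literature.NumberTheory.Automorphic.IdeleClassGroup (L : Type) →ₜ* Circle) (hμ : IsConjugateSymplectic (L : Type) μ),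
        HasWeight (L : Type) μ 1 ∧ HasCMType (L : Type) μ (line V ρ μ₀ i).lineType ∧
          (line V ρ μ₀ i).s =
            chiSplittingLine (L : Type) e₁ (frameD V) (frameD_real V) (frameD_ne V) (toHeckeCharacter (L : Type) μ)
              (isUnitary_toHeckeCharacter (L : Type) μ) ((isOscillatorChar_toHeckeCharacter_iff μ).mpr hμ)
              (realDiagonal (L : Type) (RealScalar.vec (ρ i.1)) (RealScalar.vec_real (ρ i.1)))
              (isUnit_det_realDiagonal (L : Type) (RealScalar.vec (ρ i.1)) (RealScalar.vec_real (ρ i.1)) (RealScalar.vec_ne (ρ i.1)))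
              (Matrix.diagonal (RealScalar.vec (ρ i.1)))
              (realDiagonal_map (L : Type) (RealScalar.vec (ρ i.1)) (RealScalar.vec_real (ρ i.1))).symm)
    (r : ∀ i : I V ρ μ₀, SplitLine.PhiMuLine ι₁ (line V ρ μ₀ i) → Good i → Rep ↥(maximalRealSubfield (L : Type)) (imagUnitSq (L : Type)))
    (hr : ∀ (i : I V ρ μ₀) (hi : SplitLine.PhiMuLine ι₁ (line V ρ μ₀ i)) (hg : Good i),
      (r i hi hg).toFun (locF ↥(maximalRealSubfield (L : Type)) (imagUnitSq (L : Type)) (realUnit ⟨L.K⟩ (ρ i.1).1 (ρ i.1).2.1 (ρ i.1).2.2)) =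
        realUnit ⟨L.K⟩ (ρ i.1).1 (ρ i.1).2.1 (ρ i.1).2.2)
    (R : ∀ (i : I V ρ μ₀) (_ : SplitLine.PhiMuLine ι₁ (line V ρ μ₀ i)) (_ : Good i)
      (μ : Literature.NumberTheory.Automorphic.IdeleClassGroup (L : Type) →ₜ* Circle) (_ : IsConjugateSymplectic (L : Type) μ)
      (_ : HasWeight (L : Type) μ 1),
      Thm418Rest (Model.sec42DataOf h Model.isoOf ⟨L.K⟩ ι₁ ⟨V.Hm, V.isHermitian, V.signature_ι₁, V.posDef_of_ne⟩ Φ))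
    (hR : ∀ (i : I V ρ μ₀) (hi : SplitLine.PhiMuLine ι₁ (line V ρ μ₀ i)) (hg : Good i)
      (μ : Literature.NumberTheory.Automorphic.IdeleClassGroup (L : Type) →ₜ* Circle) (hμ : IsConjugateSymplectic (L : Type) μ)
      (hw : HasWeight (L : Type) μ 1),
      Model.restOfCharDeltaPrime h ⟨L.K⟩ h6 ι₁ ⟨V.Hm, V.isHermitian, V.signature_ι₁, V.posDef_of_ne⟩ Φ e₁ (frameD V) (frameD_real V)
        (frameD_ne V) ιV (r i hi hg) μ hμ hw = R i hi hg μ hμ hw) :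
    ∃ (μ : ∀ i : I V ρ μ₀, SplitLine.PhiMuLine ι₁ (line V ρ μ₀ i) → Good i →
        (Literature.NumberTheory.Automorphic.IdeleClassGroup (L : Type) →ₜ* Circle))
      (hμ : ∀ (i : I V ρ μ₀) (hi : SplitLine.PhiMuLine ι₁ (line V ρ μ₀ i)) (hg : Good i), IsConjugateSymplectic (L : Type) (μ i hi hg))
      (hw : ∀ (i : I V ρ μ₀) (hi : SplitLine.PhiMuLine ι₁ (line V ρ μ₀ i)) (hg : Good i), HasWeight (L : Type) (μ i hi hg) 1)
      (σ : ∀ (i : I V ρ μ₀) (hi : SplitLine.PhiMuLine ι₁ (line V ρ μ₀ i)) (hg : Good i),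
        {χ : (line V ρ μ₀ i).CharW // (line V ρ μ₀ i).IsAutChar χ} →
          (toThm418Data _ (R i hi hg (μ i hi hg) (hμ i hi hg) (hw i hi hg))).AdmIndex)
      (e : ∀ (i : I V ρ μ₀) (hi : SplitLine.PhiMuLine ι₁ (line V ρ μ₀ i)) (hg : Good i)
        (a : {χ : (line V ρ μ₀ i).CharW // (line V ρ μ₀ i).IsAutChar χ}),
        (line V ρ μ₀ i).Ω ιV a.1 ≃ₗ[ℂ] (toThm418Data _ (R i hi hg (μ i hi hg) (hμ i hi hg) (hw i hi hg))).omegaAt (σ i hi hg a)),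
      (∀ (i : I V ρ μ₀) (hi : SplitLine.PhiMuLine ι₁ (line V ρ μ₀ i)) (hg : Good i),
          HasCMType (L : Type) (μ i hi hg) (line V ρ μ₀ i).lineType) ∧
      (∀ (i : I V ρ μ₀) (hi : SplitLine.PhiMuLine ι₁ (line V ρ μ₀ i)) (hg : Good i), Function.Injective (σ i hi hg)) ∧
      (∀ (i : I V ρ μ₀) (hi : SplitLine.PhiMuLine ι₁ (line V ρ μ₀ i)) (hg : Good i)
          (a : {χ : (line V ρ μ₀ i).CharW // (line V ρ μ₀ i).IsAutChar χ}) (g : ↥V.adelicFin) (m : (line V ρ μ₀ i).Ω ιV a.1),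
          e i hi hg a (MonoidAlgebra.of ℂ ↥V.adelicFin g • m) =
            (toThm418Data _ (R i hi hg (μ i hi hg) (hμ i hi hg) (hw i hi hg))).rhoAt (σ i hi hg a) g (e i hi hg a m)) := by
  choose μ hμ hw hΦ hs using key
  have H := fun (i : I V ρ μ₀) (hi : SplitLine.PhiMuLine ι₁ (line V ρ μ₀ i)) (hg : Good i) =>
    exists_pinTerms_line V ρ μ₀ ιV h h6 Φ i (r i hi hg) (hr i hi hg) (μ i hi hg) (hμ i hi hg) (hw i hi hg) _
      (hR i hi hg (μ i hi hg) (hμ i hi hg) (hw i hi hg)) (hΦ i hi hg)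
      ((line_s_eq_chiSplittingLine_iff V ρ μ₀ i (μ i hi hg) (hμ i hi hg)).1 (hs i hi hg))
  choose σ hσ e he using H
  exact ⟨μ, hμ, hw, σ, e, hΦ, hσ, he⟩

/-- **THE Ω-SLOT AT DECISION #9's SECTIONS** `r i := Rep.update Rep.ofLineOf (locF u_{a_i}) u_{a_i} rfl` (= F5's `repOfLine a_i`):
`exists_pinTerms` with `hr := Rep.update_toFun_self`; the identified rests are then the composition's per-line `(U i hi hg).rest (tail …)` at
the constant section, by `hR`. [cite: Liu2021, Thm. 4.18 (FJcycle.tex l. 2232–2237), Def. 4.12 (l. 2102–2108)] -/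
theorem exists_pinTerms_update
    (ιV : ↥V.adelicFin →*
      ↥(UnitaryGroup.finAdelic (↥(maximalRealSubfield (L : Type))) (L : Type) (IsCMField.complexConj (L : Type)) 3
        (Matrix.diagonal (frameD V))))
    (h : exists_recordSystem) [IsGalois ℚ (L : Type)] (h6 : 6 ≤ Module.finrank ℚ (L : Type)) (Φ : CMType (L : Type))
    (Good : I V ρ μ₀ → Prop)
    (key : ∀ i : I V ρ μ₀, SplitLine.PhiMuLine ι₁ (line V ρ μ₀ i) → Good i →
      ∃ (μ : Literature.NumberTheory.Automorphic.IdeleClassGroup (L : Type) →ₜ* Circle) (hμ : IsConjugateSymplectic (L : Type) μ),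
        HasWeight (L : Type) μ 1 ∧ HasCMType (L : Type) μ (line V ρ μ₀ i).lineType ∧
          (line V ρ μ₀ i).s =
            chiSplittingLine (L : Type) e₁ (frameD V) (frameD_real V) (frameD_ne V) (toHeckeCharacter (L : Type) μ)
              (isUnitary_toHeckeCharacter (L : Type) μ) ((isOscillatorChar_toHeckeCharacter_iff μ).mpr hμ)
              (realDiagonal (L : Type) (RealScalar.vec (ρ i.1)) (RealScalar.vec_real (ρ i.1)))
              (isUnit_det_realDiagonal (L : Type) (RealScalar.vec (ρ i.1)) (RealScalar.vec_real (ρ i.1)) (RealScalar.vec_ne (ρ i.1)))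
              (Matrix.diagonal (RealScalar.vec (ρ i.1)))
              (realDiagonal_map (L : Type) (RealScalar.vec (ρ i.1)) (RealScalar.vec_real (ρ i.1))).symm)
    (R : ∀ (i : I V ρ μ₀) (_ : SplitLine.PhiMuLine ι₁ (line V ρ μ₀ i)) (_ : Good i)
      (μ : Literature.NumberTheory.Automorphic.IdeleClassGroup (L : Type) →ₜ* Circle) (_ : IsConjugateSymplectic (L : Type) μ)
      (_ : HasWeight (L : Type) μ 1),
      Thm418Rest (Model.sec42DataOf h Model.isoOf ⟨L.K⟩ ι₁ ⟨V.Hm, V.isHermitian, V.signature_ι₁, V.posDef_of_ne⟩ Φ))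
    (hR : ∀ (i : I V ρ μ₀) (hi : SplitLine.PhiMuLine ι₁ (line V ρ μ₀ i)) (hg : Good i)
      (μ : Literature.NumberTheory.Automorphic.IdeleClassGroup (L : Type) →ₜ* Circle) (hμ : IsConjugateSymplectic (L : Type) μ)
      (hw : HasWeight (L : Type) μ 1),
      Model.restOfCharDeltaPrime h ⟨L.K⟩ h6 ι₁ ⟨V.Hm, V.isHermitian, V.signature_ι₁, V.posDef_of_ne⟩ Φ e₁ (frameD V) (frameD_real V)
        (frameD_ne V) ιV
        (Rep.update ↥(maximalRealSubfield (L : Type)) (imagUnitSq (L : Type))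
          (Rep.ofLineOf ↥(maximalRealSubfield (L : Type)) (imagUnitSq (L : Type)))
          (locF ↥(maximalRealSubfield (L : Type)) (imagUnitSq (L : Type)) (realUnit ⟨L.K⟩ (ρ i.1).1 (ρ i.1).2.1 (ρ i.1).2.2))
          (realUnit ⟨L.K⟩ (ρ i.1).1 (ρ i.1).2.1 (ρ i.1).2.2) rfl)
        μ hμ hw = R i hi hg μ hμ hw) :
    ∃ (μ : ∀ i : I V ρ μ₀, SplitLine.PhiMuLine ι₁ (line V ρ μ₀ i) → Good i →
        (Literature.NumberTheory.Automorphic.IdeleClassGroup (L : Type) →ₜ* Circle))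
      (hμ : ∀ (i : I V ρ μ₀) (hi : SplitLine.PhiMuLine ι₁ (line V ρ μ₀ i)) (hg : Good i), IsConjugateSymplectic (L : Type) (μ i hi hg))
      (hw : ∀ (i : I V ρ μ₀) (hi : SplitLine.PhiMuLine ι₁ (line V ρ μ₀ i)) (hg : Good i), HasWeight (L : Type) (μ i hi hg) 1)
      (σ : ∀ (i : I V ρ μ₀) (hi : SplitLine.PhiMuLine ι₁ (line V ρ μ₀ i)) (hg : Good i),
        {χ : (line V ρ μ₀ i).CharW // (line V ρ μ₀ i).IsAutChar χ} →
          (toThm418Data _ (R i hi hg (μ i hi hg) (hμ i hi hg) (hw i hi hg))).AdmIndex)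
      (e : ∀ (i : I V ρ μ₀) (hi : SplitLine.PhiMuLine ι₁ (line V ρ μ₀ i)) (hg : Good i)
        (a : {χ : (line V ρ μ₀ i).CharW // (line V ρ μ₀ i).IsAutChar χ}),
        (line V ρ μ₀ i).Ω ιV a.1 ≃ₗ[ℂ] (toThm418Data _ (R i hi hg (μ i hi hg) (hμ i hi hg) (hw i hi hg))).omegaAt (σ i hi hg a)),
      (∀ (i : I V ρ μ₀) (hi : SplitLine.PhiMuLine ι₁ (line V ρ μ₀ i)) (hg : Good i),
          HasCMType (L : Type) (μ i hi hg) (line V ρ μ₀ i).lineType) ∧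
      (∀ (i : I V ρ μ₀) (hi : SplitLine.PhiMuLine ι₁ (line V ρ μ₀ i)) (hg : Good i), Function.Injective (σ i hi hg)) ∧
      (∀ (i : I V ρ μ₀) (hi : SplitLine.PhiMuLine ι₁ (line V ρ μ₀ i)) (hg : Good i)
          (a : {χ : (line V ρ μ₀ i).CharW // (line V ρ μ₀ i).IsAutChar χ}) (g : ↥V.adelicFin) (m : (line V ρ μ₀ i).Ω ιV a.1),
          e i hi hg a (MonoidAlgebra.of ℂ ↥V.adelicFin g • m) =
            (toThm418Data _ (R i hi hg (μ i hi hg) (hμ i hi hg) (hw i hi hg))).rhoAt (σ i hi hg a) g (e i hi hg a m)) :=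
  exists_pinTerms V ρ μ₀ ιV h h6 Φ Good key
    (fun i _ _ => Rep.update ↥(maximalRealSubfield (L : Type)) (imagUnitSq (L : Type))
      (Rep.ofLineOf ↥(maximalRealSubfield (L : Type)) (imagUnitSq (L : Type)))
      (locF ↥(maximalRealSubfield (L : Type)) (imagUnitSq (L : Type)) (realUnit ⟨L.K⟩ (ρ i.1).1 (ρ i.1).2.1 (ρ i.1).2.2))
      (realUnit ⟨L.K⟩ (ρ i.1).1 (ρ i.1).2.1 (ρ i.1).2.2) rfl)
    (fun i _ _ => update_toFun_line V ρ μ₀ i) R hR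

end Packaging

end HodgeCM.Model.LiuIndex.OmegaPin

end
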